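import Summits.NavierStokesRegularity.NavierStokesRegularity.Theses.AxisymmetricExtremality
import Summits.NavierStokesRegularity.NavierStokesRegularity.Theorems.AxisymmetricSwirlRegularity
import Literature.Analysis.FluidPDE.AxisymmetricEuler
import Literature.Analysis.FluidPDE.RusinSverakSingularPoint
import HarnessLib.Audit

/-!
# Strategist s12-g6 (family `s`, gen 6, INDEPENDENT census) — typed companion to
# `STRATEGY-CENSUS-s12-g6.md` for crux `AxisymmetricExtremality.AxisymmetricKatoGlobal`
# (stmt-NavierStokesRegularity-15453).

Nothing here is a registered line or a stub: these are the SIGNATURES the census refers to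
(weaker intermediates, the typed split candidates, the strengthening), each elaborated, plus the
two closed logical facts about the threshold instance `T₀`:

* `thresholdInstance_of_crux   : AxisymmetricKatoGlobal → ThresholdInstance`
* `closes_of_thresholdInstance : MinimalDatumPFold → PFoldToAxisymmetric → ThresholdInstance → NavierStokesRegularity`

so `T₀` is the weakest statement that can replace the crux in the route's `closes` VERBATIM.
No `sorry`.
-/

noncomputable section

open Set MeasureTheory Filter Topology Function Metric
open scoped ENNReal NNReal
open Literature.Analysis.FluidPDE Literature.Analysis.FunctionSpaces
open Summit.NavierStokesRegularity.NavierStokesRegularity.Theses.AxisymmetricExtremality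

namespace Summit.NavierStokesRegularity.NavierStokesRegularity.Cruxes.AxisymmetricKatoGlobal.StrategistS12g6

local notation "ℝ³" => EuclideanSpace ℝ (Fin 3)
local notation "ℂ³" => EuclideanSpace ℂ (Fin 3)

/-! ## §A Weaker intermediates (what could replace the crux in `closes`) -/

/-- **T₀ — the threshold instance.** No `Ḣ^{1/2}`-minimal blow-up datum (Rusin–Šverák class `M`,
`IsMinimalBlowupDatum`) is axisymmetric (symmetry clause verbatim as in the crux). Strictly weaker
than the crux (it is the crux restricted to the threshold sphere `‖g‖ = ρ_max^pure(ν)`), and the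
weakest statement the route's `closes` can consume in place of the crux (`closes_of_thresholdInstance`). -/
def ThresholdInstance : Prop :=
  ∀ ν : ℝ, 0 < ν → ¬ ∃ (u₀ : ℝ³ → ℝ³) (g : HomSobolev ℝ³ ℂ³ (1 / 2 : ℝ)),
    IsMinimalBlowupDatum ν u₀ g ∧
      ∀ (θ : ℝ) (x : ℝ³), u₀ (WithLp.toLp 2 ![Real.cos θ * x 0 - Real.sin θ * x 1,
        Real.sin θ * x 0 + Real.cos θ * x 1, x 2]) = WithLp.toLp 2 ![Real.cos θ * u₀ x 0 -
        Real.sin θ * u₀ x 1, Real.sin θ * u₀ x 0 + Real.cos θ * u₀ x 1, u₀ x 2]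

/-- The crux implies the threshold instance (pure logic: a minimal blow-up datum has no global
Kato solution). -/
theorem thresholdInstance_of_crux (h : AxisymmetricKatoGlobal) : ThresholdInstance := by
  rintro ν hν ⟨u₀, g, hmin, hax⟩
  obtain ⟨hL3, hrep, hdiv, -, hnot⟩ := hmin
  exact hnot (h ν hν u₀ g hL3 hrep hdiv hax)

/-- `T₀` replaces the crux in the route's deciding theorem verbatim (same proof shape as
`AxisymmetricExtremality.closes`). -/
theorem closes_of_thresholdInstance (h₂ : MinimalDatumPFold) (h₄ : PFoldToAxisymmetric)
    (hT : ThresholdInstance) : NavierStokesRegularity := by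
  show Literature.NS.NavierStokesExistenceSmoothR3
  intro ν hν u₀ hsm hdiv hdec
  by_contra hno
  exact hT ν hν (h₄ ν hν (h₂ ν hν ⟨u₀, hsm, hdiv, hdec, hno⟩))

/-- **W_Clay — the Clay-class axisymmetric-with-swirl problem (ns.S25, Ladyzhenskaya 1968).**
Strictly weaker than Clay (A) and than the crux; it does NOT feed `closes` (the minimal datum is
critical-class, and "Clay-class ⟹ critical-class regularity at a fixed datum" is open even
without symmetry for HOMOGENEOUS data: Tao arXiv:1108.1165 Theorem 20 / Remark 21 pass through forced
statements). Cited, not restated. -/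
def ClayClassAX : Prop :=
  Summit.NavierStokesRegularity.NavierStokesRegularity.AxisymmetricSwirlRegularity

/-- **W_E — the crux restricted to FINITE-ENERGY critical data** (`u₀ ∈ L² ∩ L³`, `Ḣ^{1/2}`-represented).
Weaker than the crux; off-path: gluing it into `closes` needs "some minimal blow-up datum has finite
energy", blocked by the closedness of the blow-up set (cut-offs of a threshold datum are sub-threshold). -/
def FiniteEnergyAKG : Prop :=
  ∀ ν : ℝ, 0 < ν → ∀ (u₀ : ℝ³ → ℝ³) (g : HomSobolev ℝ³ ℂ³ (1 / 2 : ℝ)),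
    MemLp u₀ 2 volume → MemLp u₀ 3 volume → g.Represents (EuclideanSpace.complexify ∘ u₀) →
    IsWeaklyDivFree u₀ → IsAxisymmetric u₀ → HasGlobalKatoSolution ν u₀

/-- **W_∞ — the crux restricted to SMOOTH critical data.** Equivalent to the crux (restart at any
`t₀ > 0`: Kato solutions are smooth for positive times and the class is autonomous), so no gain;
recorded to make the point that data regularity is not where the difficulty sits. -/
def SmoothDataAKG : Prop :=
  ∀ ν : ℝ, 0 < ν → ∀ (u₀ : ℝ³ → ℝ³) (g : HomSobolev ℝ³ ℂ³ (1 / 2 : ℝ)),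
    ContDiff ℝ (⊤ : ℕ∞) u₀ → MemLp u₀ 3 volume → g.Represents (EuclideanSpace.complexify ∘ u₀) →
    IsWeaklyDivFree u₀ → IsAxisymmetric u₀ → HasGlobalKatoSolution ν u₀

/-! ## §B Typed split candidates (none qualifies — see the census) -/

/-- **B2, piece 2 — uniform-in-time smallness of the swirl at the axis up to the final time** (for the
Kato solution on `[0,T)`, in the binder frame of the registered stub `stub_swirlAxisModulus`).
Strictly weaker than the registered `log³`-modulus stub, but it is still an a-priori estimate at the
critical level with no known mechanism, and NO printed criterion consumes smallness without a rate
(Chen–Fang–Zhang Thm 1.1(2) needs `d < 1`, Lei–Zhang Cor. 1.3 / Wei Cor. 1.1 / Seregin 2022 need a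
log-modulus) — so its partner piece `LocalSmallSwirlCriterion` is open too. -/
def UniformSmallSwirlNearAxis : Prop :=
  ∀ ν : ℝ, 0 < ν → ∀ T : ℝ, 0 < T → ∀ (u₀ : ℝ³ → ℝ³) (g : HomSobolev ℝ³ ℂ³ (1 / 2 : ℝ))
    (u : ℝ → ℝ³ → ℝ³), g.Represents (EuclideanSpace.complexify ∘ u₀) →
    IsKatoSolutionOn T ν u₀ u → ContDiffOn ℝ (⊤ : ℕ∞) (uncurry u) (Ioo 0 T ×ˢ univ) →
    (∀ t ∈ Ioo 0 T, IsAxisymmetric (u t)) →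
    ∀ ε : ℝ, 0 < ε → ∀ t₀ ∈ Ioo 0 T, ∃ δ₀ : ℝ, 0 < δ₀ ∧
      ∀ t ∈ Ico t₀ T, ∀ x : ℝ³, cylRadius x ≤ δ₀ → |swirl (u t) x| ≤ ε * ν

/-- **B2, piece 1 — the (unprinted) local small-swirl continuation criterion in the Kato class**:
some absolute `ε > 0` such that uniform smallness `|Γ| ≤ ε ν` on `[t₀,T) × {r ≤ δ₀}` lets the Kato
solution stay bounded up to `T`. Open (it is the localised form of route `SwirlThreshold`'s crux
`SmallSwirlRegularity`, flagged "may be false" there); every printed criterion needs a RATE at the axis. -/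
def LocalSmallSwirlCriterion : Prop :=
  ∃ ε : ℝ, 0 < ε ∧ ∀ ν : ℝ, 0 < ν → ∀ T : ℝ, 0 < T → ∀ (u₀ : ℝ³ → ℝ³)
    (g : HomSobolev ℝ³ ℂ³ (1 / 2 : ℝ)) (u : ℝ → ℝ³ → ℝ³),
    g.Represents (EuclideanSpace.complexify ∘ u₀) →
    IsKatoSolutionOn T ν u₀ u → ContDiffOn ℝ (⊤ : ℕ∞) (uncurry u) (Ioo 0 T ×ˢ univ) →
    (∀ t ∈ Ioo 0 T, IsAxisymmetric (u t)) →
    (∃ t₀ ∈ Ioo 0 T, ∃ δ₀ : ℝ, 0 < δ₀ ∧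
      ∀ t ∈ Ico t₀ T, ∀ x : ℝ³, cylRadius x ≤ δ₀ → |swirl (u t) x| ≤ ε * ν) →
    ∃ K : ℝ, ∀ t ∈ Ico (T / 2) T, ∀ x : ℝ³, ‖u t x‖ ≤ K

/-! ## §D Strengthening candidate -/

/-- **S⁺ — uniform Hölder modulus of the swirl at the axis up to the final time** (propagation of an
axis Hölder modulus). Stronger than the registered `log³` stub (hence than the crux, given the landed
stubs), it has the bootstrap/continuity shape one would induct on — and it is exactly the statement the
linear theory cannot deliver: for the swirl equation `∂ₜΓ + b·∇Γ = ν(Δ − (2/r)∂ᵣ)Γ` with a divergence-free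
drift known a priori only in the energy class, Hölder continuity FAILS in general ("On supercritical
divergence-free drifts", arXiv:2106.02408, Thm 1.8; Seregin–Silvestre–Šverák–Zlatoš 2012). -/
def UniformAxisHolderModulus : Prop :=
  ∀ ν : ℝ, 0 < ν → ∀ T : ℝ, 0 < T → ∀ (u₀ : ℝ³ → ℝ³) (g : HomSobolev ℝ³ ℂ³ (1 / 2 : ℝ))
    (u : ℝ → ℝ³ → ℝ³), g.Represents (EuclideanSpace.complexify ∘ u₀) →
    IsKatoSolutionOn T ν u₀ u → ContDiffOn ℝ (⊤ : ℕ∞) (uncurry u) (Ioo 0 T ×ˢ univ) →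
    (∀ t ∈ Ioo 0 T, IsAxisymmetric (u t)) →
    ∀ t₀ ∈ Ioo 0 T, ∃ C α δ₀ : ℝ, 0 < α ∧ 0 < δ₀ ∧
      ∀ t ∈ Ico t₀ T, ∀ x : ℝ³, cylRadius x ≤ δ₀ → |swirl (u t) x| ≤ C * cylRadius x ^ α

end Summit.NavierStokesRegularity.NavierStokesRegularity.Cruxes.AxisymmetricKatoGlobal.StrategistS12g6

end
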